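import Mathlib
import Literature.Algebra.Polynomial.NewtonPolytope
import Literature.Computability.AlgebraicComplexity.GrochowMonotoneCircuitQuasiPolyEF
import Literature.Computability.AlgebraicComplexity.MonotoneCircuitNewtonPolytopeXC
import Literature.Barriers.PneNP.ExtendedFormulationLinearImage
import HarnessLib

/-!
# Grochow's Main Lemma 3.1 — discharge of `Grochow.lemma_3_1`

D-0014 keeps `Literature/` sorry-free by stating cited results as named facts.  This file proves
the named fact `Literature.Computability.AlgebraicComplexity.Grochow.lemma_3_1` of
`GrochowMonotoneCircuitQuasiPolyEF.lean` — J. A. Grochow, *Monotone projection lower bounds from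
extended formulation lower bounds*, Theory of Computing **13** (2017), art. 18, Lemma 3.1 (Main
Lemma), in the structural form typed there: for a monotone simple substitution
`π : σ → τ ⊕ ℝ≥0` (each variable `y_i` of `g` goes to a variable `x_{π i}` or to a nonnegative
constant) and `f := g ∘ π`,

  `Newt(f) = ℓ_π (Newt(g) ∩ K)`,  `K := {e | e_i = 0 whenever π i = 0}`,
  `ℓ_π(e)_j := ∑_{i : π i = x_j} e_i`:

* `Literature.Computability.AlgebraicComplexity.Grochow.lemma_3_1_holds : lemma_3_1`;
* `Literature.Computability.AlgebraicComplexity.Grochow.monotoneCircuitQuasiPolyEF_holds :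
  monotoneCircuitQuasiPolyEF` — the degree-qualified composite circuit-to-EF bound of the fact file
  (`xc(Newt f) ≤ 2^{C (log₂ s + log₂ d + 1)²}` for a monotone fan-in-two circuit of size `≤ s`), obtained
  by feeding the tree's LINEAR circuit bound `MonotoneCircuitEF.theorem35_circuit`
  (`MonotoneCircuitNewtonPolytopeXC.lean`: size `≤ s` ⇒ `HasEFOfSize (Newt f) (3 s)`, a proved extension
  of Hrubeš–Yehudayoff's Thm. 35 to circuits) to `monotoneCircuitQuasiPolyEF_of_circuitXC`;
* `Literature.Computability.AlgebraicComplexity.Grochow.hasEFOfSize_newtonPolytope_aeval` — Lemma 3.1's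
  "In particular, `xc(New(f)) ≤ c(New(g))`" EXACTLY (no additive loss): `HasEFOfSize (Newt g) r →
  HasEFOfSize (Newt (g ∘ π)) r`, from `lemma_3_1_holds`, the free face lemma `HasEFOfSize.inter_eqs` and
  the free linear-image lemma `HasEFOfSize.image_linearMap` (`ExtendedFormulationLinearImage.lean`);
  it sharpens `hasEFOfSize_of_lemma_3_1` of the fact file (`|σ| + r`).

Its consumers in the fact file (`hasEFOfSize_of_lemma_3_1`, and through it the extension-
complexity transfer `xc(Newt f) ≤ m + xc(Newt g)`) can now be fed `lemma_3_1_holds`.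

## The printed proof and the one formalised

We follow Grochow's proof (§3, p. 6 of the arXiv version) claim by claim, over the semiring
`R = ℝ≥0` of the typed statement.

* *Monomials go to scaled monomials.*  `elim_pow`, `prod_elim_pow`: the substituted monomial
  `∏_i (π i)^{e_i}` is `κ(e) · x^{Λ(e)}` with `Λ(e) := ∑_{π i = x_j} e_i [j]` and
  `κ(e) := ∏_{π i = c} c^{e_i}`; `coeff_aeval_elim` collects the coefficients of `f`.
* *Claim 1 (no cancellation).*  Since all coefficients are nonnegative, a monomial of `f` is
  exactly the image `Λ(e)` of a monomial `e` of `g` with `κ(e) ≠ 0`, i.e. with `e ∈ K`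
  (`prod_coef_ne_zero_iff`, `mem_support_aeval_elim`); and `exponentPt (Λ e) = ℓ_π (exponentPt e)`
  (`ell_exponentPt`).  Hence the exponent points of `f` are `ℓ_π` of those of `g` lying in `K`.
* *Claim 2 (linear images commute with convex hulls)* is Mathlib's `LinearMap.image_convexHull`.
* *Claim 3 (`P = Newt(g) ∩ K` is the convex hull of the exponent points in `K`).*  `K` is cut
  out by coordinate hyperplanes `e_i = 0` and `Newt(g)` lies in the nonnegative orthant, so
  `Newt(g) ∩ K` is a face: a convex combination of exponent points lying in `K` puts zero weight
  on every point outside `K` (a point outside `K` has a coordinate `e_i ≥ 1 > 0` with `π i = 0`).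
  This is the `hface` step of `lemma_3_1_holds` (`Finset.mem_convexHull`,
  `Finset.centerMass_subset`).

Coefficients are moved to `ℝ` along `NNReal.toRealHom`, which is injective, so supports are
unchanged (`MvPolynomial.support_map_of_injective`).

## References

* J. A. Grochow, *Monotone projection lower bounds from extended formulation lower bounds*,
  Theory of Computing 13 (2017), article 18, 1–15, Lemma 3.1 and its proof (Claims 1–3), §3;
  arXiv:1510.08417, p. 6.  Bib key `Grochow2017`.
-/

noncomputable section

namespace Literature.Computability.AlgebraicComplexity.Grochow

open scoped NNReal
open Literature.Algebra.Polynomial.NewtonPolytope MvPolynomial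

variable {σ τ : Type}

/-- One factor of a substituted monomial: `(π i)^n` is the monomial `x_j^n` (if `π i = x_j`) or the
constant `c^n` (if `π i = c`) [folklore]. -/
private theorem elim_pow (π : σ → τ ⊕ ℝ≥0) (i : σ) (n : ℕ) :
    (Sum.elim MvPolynomial.X MvPolynomial.C (π i) : MvPolynomial τ ℝ≥0) ^ n =
      monomial (Sum.elim (fun j => Finsupp.single j n) (fun _ => 0) (π i))
        (Sum.elim (fun _ => (1 : ℝ≥0)) (fun c => c ^ n) (π i)) := by
  rcases π i with j | c
  · simp [X_pow_eq_monomial]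
  · simp only [Sum.elim_inr]
    rw [← C_pow, C_apply]

variable [Fintype σ]

/-- The substituted monomial `∏_i (π i)^{e_i}` is a single monomial `κ(e) · x^{Λ(e)}`
[folklore]. -/
private theorem prod_elim_pow (π : σ → τ ⊕ ℝ≥0) (e : σ →₀ ℕ) :
    ∏ i, (Sum.elim MvPolynomial.X MvPolynomial.C (π i) : MvPolynomial τ ℝ≥0) ^ e i =
      monomial (∑ i, Sum.elim (fun j => Finsupp.single j (e i)) (fun _ => 0) (π i))
        (∏ i, Sum.elim (fun _ => (1 : ℝ≥0)) (fun c => c ^ e i) (π i)) := by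
  simp_rw [elim_pow]
  rw [monomial_sum_index, map_prod, ← Finset.prod_mul_distrib]
  refine Finset.prod_congr rfl fun i _ => ?_
  rw [C_mul_monomial, mul_one]

/-- The coefficients of `f = g ∘ π` [folklore]. -/
private theorem coeff_aeval_elim (π : σ → τ ⊕ ℝ≥0) (g : MvPolynomial σ ℝ≥0) (m : τ →₀ ℕ)
    [DecidableEq τ] :
    (aeval (fun i => Sum.elim MvPolynomial.X MvPolynomial.C (π i)) g).coeff m =
      ∑ e ∈ g.support,
        if (∑ i, Sum.elim (fun j => Finsupp.single j (e i)) (fun _ => 0) (π i)) = m then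
          g.coeff e * ∏ i, Sum.elim (fun _ => (1 : ℝ≥0)) (fun c => c ^ e i) (π i) else 0 := by
  rw [MvPolynomial.aeval_def, MvPolynomial.eval₂_eq', coeff_sum]
  refine Finset.sum_congr rfl fun e _ => ?_
  rw [prod_elim_pow, MvPolynomial.algebraMap_eq, C_mul_monomial, coeff_monomial]

/-- `κ(e) ≠ 0` iff `e` vanishes on the variables sent to `0` [folklore]. -/
private theorem prod_coef_ne_zero_iff (π : σ → τ ⊕ ℝ≥0) (e : σ →₀ ℕ) :
    (∏ i, Sum.elim (fun _ => (1 : ℝ≥0)) (fun c => c ^ e i) (π i)) ≠ 0 ↔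
      ∀ i, π i = Sum.inr 0 → e i = 0 := by
  rw [Finset.prod_ne_zero_iff]
  simp only [Finset.mem_univ, forall_true_left]
  refine forall_congr' fun i => ?_
  rcases π i with j | c
  · simp
  · simp only [Sum.elim_inr, Sum.inr.injEq]
    constructor
    · intro h hc
      subst hc
      by_contra hne
      exact h (zero_pow hne)
    · intro h
      by_cases hc : c = 0
      · subst hc
        rw [h rfl, pow_zero]
        exact one_ne_zero
      · exact pow_ne_zero _ hc

/-- The support of `f = g ∘ π`: the images `Λ(e)` of the exponents `e` of `g` vanishing on `ker π`
(no cancellation over `ℝ≥0`: Claim 1 of the proof) [folklore]. -/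
private theorem mem_support_aeval_elim (π : σ → τ ⊕ ℝ≥0) (g : MvPolynomial σ ℝ≥0) (m : τ →₀ ℕ)
    [DecidableEq τ] :
    m ∈ (aeval (fun i => Sum.elim MvPolynomial.X MvPolynomial.C (π i)) g).support ↔
      ∃ e ∈ g.support, (∀ i, π i = Sum.inr 0 → e i = 0) ∧
        (∑ i, Sum.elim (fun j => Finsupp.single j (e i)) (fun _ => 0) (π i)) = m := by
  rw [mem_support_iff, coeff_aeval_elim, Ne, Finset.sum_eq_zero_iff]
  push Not
  refine exists_congr fun e => and_congr_right fun he => ?_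
  rw [mem_support_iff] at he
  constructor
  · intro h
    by_cases hm : (∑ i, Sum.elim (fun j => Finsupp.single j (e i)) (fun _ => 0) (π i)) = m
    · rw [if_pos hm] at h
      exact ⟨(prod_coef_ne_zero_iff π e).1 (right_ne_zero_of_mul h), hm⟩
    · rw [if_neg hm] at h; exact absurd rfl h
  · rintro ⟨hK, hm⟩
    rw [if_pos hm]
    exact mul_ne_zero he ((prod_coef_ne_zero_iff π e).2 hK)

/-- `ℓ_π (exponentPt e) = exponentPt (Λ e)` [folklore]. -/
private theorem ell_exponentPt (π : σ → τ ⊕ ℝ≥0) [DecidableEq τ] (e : σ →₀ ℕ) :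
    (fun j : τ => ∑ i ∈ Finset.univ.filter (fun i => π i = Sum.inl j), exponentPt ℝ e i) =
      exponentPt ℝ (∑ i, Sum.elim (fun j => Finsupp.single j (e i)) (fun _ => 0) (π i)) := by
  funext j
  rw [exponentPt_apply, Finsupp.finsetSum_apply, Nat.cast_sum, Finset.sum_filter]
  refine Finset.sum_congr rfl fun i _ => ?_
  rcases h : π i with j' | c
  · simp only [Sum.inl.injEq, exponentPt_apply, Sum.elim_inl, Finsupp.single_apply]
    by_cases hj : j' = j
    · simp [hj]
    · simp [hj]
  · simp

/-- **Grochow 2017, Lemma 3.1 (Main Lemma) — proved**: under a monotone (simple, nonnegative)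
substitution `π : σ → τ ⊕ ℝ≥0` the Newton polytope of `f = g ∘ π` is the image, under the
coordinate-summing linear map `ℓ_π`, of the face `Newt(g) ∩ K` of `Newt(g)` cut out by the
coordinates of the variables sent to `0`.  Discharge of the named fact `Grochow.lemma_3_1`
[cite: Grochow2017, Lemma 3.1 and its proof, Claims 1–3 (ToC 13:18, §3; arXiv:1510.08417 p. 6)]. -/
theorem lemma_3_1_holds : Literature.Computability.AlgebraicComplexity.Grochow.lemma_3_1 := by
  intro σ τ _ _ _ _ π g
  classical
  have hinj : Function.Injective (NNReal.toRealHom : ℝ≥0 →+* ℝ) := fun a b h =>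
    NNReal.coe_injective h
  -- the linear map `ℓ_π`
  let L : (σ → ℝ) →ₗ[ℝ] (τ → ℝ) :=
    { toFun := fun e j => ∑ i ∈ Finset.univ.filter (fun i => π i = Sum.inl j), e i
      map_add' := fun e e' => by
        funext j; simp [Finset.sum_add_distrib]
      map_smul' := fun c e => by
        funext j; simp [Finset.mul_sum] }
  have hL :
      (fun e : σ → ℝ => fun j : τ => ∑ i ∈ Finset.univ.filter (fun i => π i = Sum.inl j), e i) =
      (L : (σ → ℝ) → (τ → ℝ)) := rfl
  -- the point sets
  set S : Finset (σ → ℝ) := g.support.image (exponentPt ℝ) with hSdef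
  set SK : Finset (σ → ℝ) := (g.support.filter fun e => ∀ i, π i = Sum.inr 0 → e i = 0).image
    (exponentPt ℝ) with hSKdef
  have hS :
      (exponentPt ℝ '' ((MvPolynomial.map NNReal.toRealHom g).support : Set (σ →₀ ℕ))) = ↑S := by
    rw [support_map_of_injective _ hinj, hSdef, Finset.coe_image]
  -- Claim 1: the exponent points of `f` are `ℓ_π (SK)`
  have hf : (exponentPt ℝ '' ((MvPolynomial.map NNReal.toRealHom
      (aeval (fun i => Sum.elim MvPolynomial.X MvPolynomial.C (π i)) g)).support : Set (τ →₀ ℕ))) =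
      L '' (↑SK : Set (σ → ℝ)) := by
    rw [support_map_of_injective _ hinj]
    ext y
    simp only [Set.mem_image, Finset.mem_coe, hSKdef, Finset.mem_image, Finset.mem_filter]
    constructor
    · rintro ⟨m, hm, rfl⟩
      obtain ⟨e, he, hK, rfl⟩ := (mem_support_aeval_elim π g m).1 hm
      exact ⟨exponentPt ℝ e, ⟨e, ⟨he, hK⟩, rfl⟩, ell_exponentPt π e⟩
    · rintro ⟨x, ⟨e, ⟨he, hK⟩, rfl⟩, rfl⟩
      exact ⟨_, (mem_support_aeval_elim π g _).2 ⟨e, he, hK, rfl⟩, (ell_exponentPt π e).symm⟩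
  -- Claim 3: the face identity `conv(SK) = conv(S) ∩ K`
  have hnonneg : ∀ y ∈ S, ∀ i, (0 : ℝ) ≤ y i := by
    intro y hy i
    obtain ⟨e, _, rfl⟩ := Finset.mem_image.1 hy
    simp
  have hface : convexHull ℝ (↑SK : Set (σ → ℝ)) =
      convexHull ℝ (↑S : Set (σ → ℝ)) ∩ {x | ∀ i, π i = Sum.inr 0 → x i = 0} := by
    have hsub : SK ⊆ S := Finset.image_subset_image (Finset.filter_subset _ _)
    apply Set.Subset.antisymm
    · refine Set.subset_inter (convexHull_mono (Finset.coe_subset.2 hsub)) ?_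
      refine convexHull_min ?_ ?_
      · intro y hy i hi
        obtain ⟨e, he, rfl⟩ := Finset.mem_image.1 (Finset.mem_coe.1 hy)
        have := (Finset.mem_filter.1 he).2 i hi
        simp [this]
      · intro x hx y hy a b _ _ _ i hi
        simp [hx i hi, hy i hi]
    · rintro x ⟨hx, hxK⟩
      obtain ⟨w, hw0, hw1, hwx⟩ := Finset.mem_convexHull.1 hx
      -- weights outside `SK` vanish
      have key : ∀ y ∈ S, y ∉ SK → w y = 0 := by
        intro y hy hySK
        obtain ⟨e, he, rfl⟩ := Finset.mem_image.1 hy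
        have hnot : ¬ ∀ i, π i = Sum.inr 0 → e i = 0 := by
          intro hK
          exact hySK (Finset.mem_image.2 ⟨e, Finset.mem_filter.2 ⟨he, hK⟩, rfl⟩)
        push Not at hnot
        obtain ⟨i, hi, hei⟩ := hnot
        have hxi : x i = ∑ y ∈ S, w y * y i := by
          rw [← hwx, Finset.centerMass_eq_of_sum_1 _ _ hw1, Finset.sum_apply]
          simp
        have hsum0 : ∑ y ∈ S, w y * y i = 0 := by rw [← hxi]; exact hxK i hi
        have hterm := (Finset.sum_eq_zero_iff_of_nonneg (fun y hy =>
          mul_nonneg (hw0 y hy) (hnonneg y hy i))).1 hsum0 _ hy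
        have hpos : (0 : ℝ) < exponentPt ℝ e i := by
          simp only [exponentPt_apply, Nat.cast_pos]
          omega
        rcases mul_eq_zero.1 hterm with h | h
        · exact h
        · exact absurd h hpos.ne'
      refine Finset.mem_convexHull.2 ⟨w, fun y hy => hw0 y (hsub hy), ?_, ?_⟩
      · rw [Finset.sum_subset hsub key]; exact hw1
      · rw [Finset.centerMass_subset _ hsub key]; exact hwx
  -- assemble
  rw [newtonPolytope_def, newtonPolytope_def, hf, hS, hL, ← LinearMap.image_convexHull, hface]

/-- **The composite circuit-to-EF bound — proved.**  Discharge of the named fact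
`Grochow.monotoneCircuitQuasiPolyEF` (the degree-qualified `2^{O((log s + log d)²)}` bound assembled in
Grochow's proof of Cor. 4.6) from the tree's linear circuit bound `MonotoneCircuitEF.theorem35_circuit`
via `monotoneCircuitQuasiPolyEF_of_circuitXC`.
[cite: Grochow2017, proof of Corollary 4.6 with Lemma 3.1 and Proposition 4.5 (arXiv:1510.08417 pp. 6–8)]
[cite: HrubesYehudayoff2021, Theorem 35] -/
theorem monotoneCircuitQuasiPolyEF_holds :
    Literature.Computability.AlgebraicComplexity.Grochow.monotoneCircuitQuasiPolyEF :=
  monotoneCircuitQuasiPolyEF_of_circuitXC MonotoneCircuitEF.theorem35_circuit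

/-- **Lemma 3.1, "In particular, `xc(New(f)) ≤ c(New(g))`" — exact form.**  If `New(g) ⊆ ℝ^σ` has a
slack-form extended formulation with `r` inequalities then so does `New(f)` for `f = g ∘ π` any monotone
(simple, non-negative) substitution `π : σ → τ ⊕ ℝ≥0`: `New(f) = ℓ_π (New(g) ∩ K)` (`lemma_3_1_holds`),
the face `New(g) ∩ K` is free (`HasEFOfSize.inter_eqs`) and so is the linear image under `ℓ_π`
(`HasEFOfSize.image_linearMap`).  Sharpens `hasEFOfSize_of_lemma_3_1` (`|σ| + r`).
[cite: Grochow2017, Lemma 3.1 (ToC 13:18 §3; arXiv:1510.08417 p. 6)] -/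
theorem hasEFOfSize_newtonPolytope_aeval {σ τ : Type} [Fintype σ] [Fintype τ] [DecidableEq σ]
    [DecidableEq τ] (π : σ → τ ⊕ ℝ≥0) (g : MvPolynomial σ ℝ≥0) {r : ℕ}
    (hg : Literature.Barriers.PneNP.HasEFOfSize
      (newtonPolytope (MvPolynomial.map NNReal.toRealHom g)) r) :
    Literature.Barriers.PneNP.HasEFOfSize (newtonPolytope (MvPolynomial.map NNReal.toRealHom
      (MvPolynomial.aeval (fun i => Sum.elim MvPolynomial.X MvPolynomial.C (π i)) g))) r := by
  classical
  rw [lemma_3_1_holds σ τ π g]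
  -- the face `New(g) ∩ K` is free
  have hface : Literature.Barriers.PneNP.HasEFOfSize
      (newtonPolytope (MvPolynomial.map NNReal.toRealHom g) ∩
        {e : σ → ℝ | ∀ i, π i = Sum.inr 0 → e i = 0}) r := by
    have h := hg.inter_eqs (T := {i : σ // π i = Sum.inr 0}) (fun t => Pi.single (t.1 : σ) (1 : ℝ))
      (fun _ => 0)
    convert h using 2
    ext e
    simp only [Set.mem_setOf_eq, Subtype.forall]
    refine forall_congr' fun i => forall_congr' fun _ => ?_
    rw [dotProduct_comm, dotProduct_single, mul_one]
  -- the linear map `ℓ_π` is free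
  let L : (σ → ℝ) →ₗ[ℝ] (τ → ℝ) :=
    { toFun := fun e j => ∑ i ∈ Finset.univ.filter (fun i => π i = Sum.inl j), e i
      map_add' := fun e e' => by
        funext j; simp [Finset.sum_add_distrib]
      map_smul' := fun c e => by
        funext j; simp [Finset.mul_sum] }
  have hL :
      (fun e : σ → ℝ => fun j : τ => ∑ i ∈ Finset.univ.filter (fun i => π i = Sum.inl j), e i) =
      (L : (σ → ℝ) → (τ → ℝ)) := rfl
  rw [hL]
  exact hface.image_linearMap L

end Literature.Computability.AlgebraicComplexity.Grochow

end
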